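import Literature.Geometry.Kaehler.RiemannianHodgeSmoothProofs
import HarnessLib

/-!
# The codifferential of a smooth form is smooth: corrected named fact (Warner (1983), 6.1 (2))

Companion of `Literature/Geometry/Kaehler/RiemannianHodge.lean` (§*Smoothness statements*) and
`Literature/Geometry/Kaehler/RiemannianHodgeSmoothProofs.lean`.

The named fact `Literature.Geometry.Kaehler.isSmoothForm_mcoderiv` ("the codifferential of a
smooth form is smooth", Warner, *Foundations of Differentiable Manifolds and Lie Groups*, GTM 94,
6.1 (2), p. 220: "We define an operator `δ` from `p`-forms to `(p-1)` forms by setting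
`δ = (-1)^{n(p+1)+1} *d*`", an operator on the smooth forms `E^p(M)` by 4.10 (6), p. 150: "`*`
takes smooth forms to smooth forms") is declared in a section of `RiemannianHodge.lean` whose
instance variables `[IsManifold I ∞ M]`, `[IsContinuousRiemannianBundle E (TangentSpace I)]`,
`[IsContMDiffRiemannianBundle I ∞ E (TangentSpace I)]` are not used in its body and hence — a
`def` abstracts only the section variables it mentions — are **not** hypotheses of the fact:
`#check @isSmoothForm_mcoderiv` lists `[RiemannianBundle (TangentSpace I)]` (a fibrewise family
of inner products with no regularity in the base point) as the only assumption on the metric. In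
that generality the statement is false: on `ℝ²` with `g_x = diag(λ(x), λ(x)⁻¹)`, `λ` a
`{1, 2}`-valued step function, the volume form is the constant `dx₀ ∧ dx₁` (so the hypothesis
`ho` holds) and for the smooth `2`-form `β = x₀ · vol` one has `δβ = -⋆d⋆β = -λ⁻¹ dx₁`, not even
continuous (formal refutation: `StepMetric.not_isSmoothForm_mcoderiv_stepMetric` in
`RiemannianHodgeSmoothCounterexample.lean`; the same defect of `isSmoothForm_hodgeStar` is
treated in `RiemannianHodgeSmoothProofs.lean` and refuted in `RiemannianHodgeRoughMetric.lean`).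

Following D-0014 the original def is left untouched; this file vendors the **corrected, closed
statement** `isSmoothForm_mcoderiv_of_isContMDiffRiemannianBundle` (the intended hypotheses
`[IsManifold I ∞ M]`, `[IsContMDiffRiemannianBundle I ∞ E (TangentSpace I)]` bound inside, as for
`isSmoothForm_hodgeStar_of_isContMDiffRiemannianBundle`; `IsContinuousRiemannianBundle` is not
needed) and discharges it by `IsSmoothForm.mcoderiv` of `RiemannianHodgeSmoothProofs.lean`
(Warner's route: `δ = ±⋆d⋆` with `⋆` smooth by the Gram–Schmidt orthonormal frame field of
4.10 and `d` smooth by 2.20). The usable forms are `IsSmoothForm.mcoderiv` and, for the fact as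
declared under the intended instances, `isSmoothForm_mcoderiv_of_contMDiffMetric` (both in
`RiemannianHodgeSmoothProofs.lean`).

## References

* F. W. Warner, *Foundations of Differentiable Manifolds and Lie Groups*, GTM 94, Springer
  (1983): 6.1 (2), p. 220; 4.10 (6), p. 150.
-/

noncomputable section

open scoped Manifold ContDiff
open Bundle Module

namespace Literature.Geometry.Kaehler

/-- **Corrected statement of the named fact `Literature.Geometry.Kaehler.isSmoothForm_mcoderiv`**
(`RiemannianHodge.lean`). On a Riemannian manifold with *smooth* metric and an orientation
family `o` with smooth volume form, the codifferential `δα = (-1)^{n(p+1)+1} ⋆d⋆α` of a smooth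
`p = k + 1`-form is smooth (Warner (1983), 6.1 (2), p. 220, with 4.10 (6), p. 150: `*` and hence
`δ` act on the smooth forms `E^p(M)`).

Discrepancy with the original: `def isSmoothForm_mcoderiv` sits in a section whose instance
variables `[IsManifold I ∞ M]`, `[IsContinuousRiemannianBundle E (TangentSpace I)]`,
`[IsContMDiffRiemannianBundle I ∞ E (TangentSpace I)]` are not used in its body and are therefore
not hypotheses of the fact, which thus quantifies over every fibrewise family of inner products
(`Bundle.RiemannianBundle`, no regularity in the base point) and is false in that generality
(`ℝ²`, `g = diag(λ, λ⁻¹)` with `λ` a `{1, 2}`-valued step function: `vol = dx₀ ∧ dx₁` is smooth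
but `δ(x₀ · vol) = -λ⁻¹ dx₁` is discontinuous; formally
`StepMetric.not_isSmoothForm_mcoderiv_stepMetric`). Here the intended hypotheses
`[IsManifold I ∞ M]` and `[IsContMDiffRiemannianBundle I ∞ E (TangentSpace I)]` are bound inside a
closed statement; it is discharged by `isSmoothForm_mcoderiv_of_isContMDiffRiemannianBundle_holds`,
and the usable form is `Literature.Geometry.Kaehler.IsSmoothForm.mcoderiv`.
[cite: WarnerGTM94, 6.1 (2), p. 220] -/
def isSmoothForm_mcoderiv_of_isContMDiffRiemannianBundle : Prop :=
  ∀ {E : Type*} [NormedAddCommGroup E] [NormedSpace ℝ E] {n : ℕ} [Fact (finrank ℝ E = n)]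
    {H : Type*} [TopologicalSpace H] {I : ModelWithCorners ℝ E H}
    {M : Type*} [TopologicalSpace M] [ChartedSpace H M] [IsManifold I ∞ M]
    [FiniteDimensional ℝ E] [RiemannianBundle (fun x : M ↦ TangentSpace I x)]
    [IsContMDiffRiemannianBundle I ∞ E (fun x : M ↦ TangentSpace I x)] {k m : ℕ}
    (o : (x : M) → Orientation ℝ (TangentSpace I x) (Fin n)),
    IsSmoothForm (riemannianVolumeForm o) → ∀ (h : (k + 1) + m = n) {α : MForm I M ℝ (k + 1)},
      IsSmoothForm α → IsSmoothForm (mcoderiv o h α)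

/-- **Discharge** of `isSmoothForm_mcoderiv_of_isContMDiffRiemannianBundle` (the corrected form
of the named fact `isSmoothForm_mcoderiv`): immediate from `IsSmoothForm.mcoderiv`
(`δ = ±⋆d⋆`: `IsSmoothForm.hodgeStar` twice around `isSmoothForm_mextDeriv`, the latter fed the
discharged chart-independence fact `inChart_mextDeriv_holds`). Warner (1983), 6.1 (2), p. 220.
[cite: WarnerGTM94, 6.1 (2), p. 220] -/
theorem isSmoothForm_mcoderiv_of_isContMDiffRiemannianBundle_holds :
    isSmoothForm_mcoderiv_of_isContMDiffRiemannianBundle :=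
  fun o ho h _ hα ↦ IsSmoothForm.mcoderiv o ho h hα

end Literature.Geometry.Kaehler
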